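import Literature.NumberTheory.LFunctions.SchoenfeldPsiSmall
import Mathlib.NumberTheory.Chebyshev
import Mathlib.NumberTheory.ArithmeticFunction.Misc
import Mathlib.NumberTheory.ArithmeticFunction.VonMangoldt
import Mathlib.Analysis.Complex.ExponentialBounds

/-!
# Stub `stub_helsonG` of crux `WeilComb.CombShapePositivity` — explicit-sums proof
(item stmt-RiemannHypothesis-11229, route route-RiemannHypothesis-WeilComb, line `Sketch`; siege k6,
variation "explicit sums")

The Helson potential bound: for every `M` and `a : ℕ → ℂ`,

`Σ_{m ≤ M} ‖a_m‖² (log m + ψ₁(M/m)) ≤ (log M + 39/50) Σ_{m ≤ M} ‖a_m‖²`, `ψ₁(K) = Σ_{n ≤ K} Λ(n)/n`.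

This file gives a proof by EXPLICIT FINITE SUMS only (Chebyshev's method), independent of the
Rosser–Schoenfeld estimate `Σ_{p ≤ x} (log p)/p < log x` ((3.24) of Rosser–Schoenfeld 1962) used by
`WeilCombCombShapePositivityStubHelsonG.lean`:

* the inequality is termwise (`‖a_m‖² ≥ 0`), and `log m + log ⌊M/m⌋ ≤ log M`, so it suffices that
  `ψ₁(K) ≤ log K + 39/50` for every natural `K ≥ 1`;
* Chebyshev's identity `Σ_{n ≤ K} Λ(n) ⌊K/n⌋ = Σ_{m ≤ K} log m = log K!` (`Λ * ζ = log`) and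
  `⌊K/n⌋ ≥ (K+1)/n − 1` give `(K+1) ψ₁(K) − ψ(K) ≤ log K!`;
* `log K! ≤ K log K − K + 1 + log K` (comparison of the sum with the integral, by induction);
* `ψ(K) ≤ (89/50) K − 11/50`: for `K ≤ 10⁴` from `ψ(x) ≤ 1.04 x` (the tree's kernel computation of
  `lcm(1,…,n)`, `SchoenfeldBound.psi_le_of_le_ten_thousand`), for `K ≥ 10⁴` from Mathlib's Chebyshev
  bound `ψ(x) ≤ x log 4 + 2 √x log x` (`Chebyshev.psi_le`);
* hence `(K+1) ψ₁(K) ≤ K log K + log K + (39/50) K + 39/50 = (K+1)(log K + 39/50)`.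

(The method yields `ψ₁(K) ≤ log K + 0.575`; the true supremum of `ψ₁(K) − log K` is `< 0`, and
`ψ₁(K) = log K − γ + o(1)`.)
-/

noncomputable section

-- the sub-problem path RiemannHypothesis/RiemannHypothesis duplicates a namespace (D-0017)
set_option linter.dupNamespace false

open scoped BigOperators Chebyshev
open ArithmeticFunction (vonMangoldt)

namespace Summit.RiemannHypothesis.RiemannHypothesis.Theorems.WeilCombBohrFejer.HelsonGK6

open Literature.NumberTheory.LFunctions

/-- Chebyshev's identity `Σ_{n ≤ K} Λ(n) ⌊K/n⌋ = Σ_{m ≤ K} log m` (`= log K!`), from `Λ * ζ = log`.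
[folklore] -/
theorem sum_vonMangoldt_mul_div_eq_sum_log (K : ℕ) :
    ∑ n ∈ Finset.Ioc 0 K, (vonMangoldt n : ℝ) * ((K / n : ℕ) : ℝ) =
      ∑ m ∈ Finset.Ioc 0 K, Real.log m := by
  rw [← ArithmeticFunction.sum_Ioc_mul_zeta_eq_sum, ArithmeticFunction.vonMangoldt_mul_zeta]
  exact Finset.sum_congr rfl fun m _ ↦ ArithmeticFunction.log_apply

/-- `log K! = Σ_{m ≤ K} log m ≤ K log K − K + 1 + log K` for `K ≥ 1` (induction on `K`, using
`1 ≤ (n+1)(log(n+1) − log n)`). [folklore] -/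
theorem sum_log_le {K : ℕ} (hK : 1 ≤ K) :
    ∑ m ∈ Finset.Ioc 0 K, Real.log m ≤ (K : ℝ) * Real.log K - K + 1 + Real.log K := by
  induction K, hK using Nat.le_induction with
  | base => simp
  | succ n hn ih =>
    rw [Finset.sum_Ioc_succ_top (Nat.zero_le n)]
    push_cast
    have hn0 : (0 : ℝ) < n := by exact_mod_cast hn
    have hn1 : (0 : ℝ) < n + 1 := by linarith
    have hlog : 1 - (((n : ℝ) + 1) / n)⁻¹ ≤ Real.log (((n : ℝ) + 1) / n) :=
      Real.one_sub_inv_le_log_of_pos (by positivity)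
    rw [Real.log_div hn1.ne' hn0.ne', inv_div] at hlog
    have h1 : 1 ≤ ((n : ℝ) + 1) * (Real.log (n + 1) - Real.log n) := by
      have := mul_le_mul_of_nonneg_left hlog hn1.le
      have e : ((n : ℝ) + 1) * (1 - n / (n + 1)) = 1 := by
        field_simp
        ring
      linarith
    nlinarith

/-- The Chebyshev input: `ψ(K) ≤ (89/50) K − 11/50` for every natural `K ≥ 1`
(`ψ(x) ≤ 1.04 x` on `[0, 10⁴]` by the kernel computation `SchoenfeldBound.psi_le_of_le_ten_thousand`,
and Mathlib's `ψ(x) ≤ x log 4 + 2 √x log x` with `log √K ≤ 7 log 2 − 1 + √K/128` beyond). [folklore] -/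
theorem psi_le_of_one_le {K : ℕ} (hK : 1 ≤ K) : ψ (K : ℝ) ≤ 89 / 50 * K - 11 / 50 := by
  have hK' : (1 : ℝ) ≤ K := by exact_mod_cast hK
  rcases le_or_gt (K : ℝ) 10000 with h | h
  · have := SchoenfeldBound.psi_le_of_le_ten_thousand (x := (K : ℝ)) (by positivity) h
    linarith
  · have hpsi := Chebyshev.psi_le hK'
    set s := Real.sqrt (K : ℝ) with hs
    have hs0 : 0 ≤ s := Real.sqrt_nonneg _
    have hsq : s ^ 2 = K := Real.sq_sqrt (by positivity)
    have hs100 : 100 ≤ s := by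
      rw [hs, show (100 : ℝ) = Real.sqrt (100 ^ 2) by rw [Real.sqrt_sq (by norm_num)]]
      exact Real.sqrt_le_sqrt (by nlinarith)
    have hlogK : Real.log K = 2 * Real.log s := by
      rw [← hsq, Real.log_pow]
      norm_num
    have hlogs : Real.log s ≤ 7 * Real.log 2 - 1 + s / 128 := by
      have h1 := Real.log_le_sub_one_of_pos (show (0 : ℝ) < s / 128 by positivity)
      rw [Real.log_div (by positivity) (by norm_num)] at h1
      have h128 : Real.log (128 : ℝ) = 7 * Real.log 2 := by
        rw [show (128 : ℝ) = 2 ^ 7 by norm_num, Real.log_pow]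
        norm_num
      linarith
    have hl2 := Real.log_two_lt_d9
    have hl2' := Real.log_two_gt_d9
    have hlog4 : Real.log 4 = 2 * Real.log 2 := by
      rw [show (4 : ℝ) = 2 ^ 2 by norm_num, Real.log_pow]
      norm_num
    rw [hlog4, hlogK] at hpsi
    -- `hpsi : ψ K ≤ 2 log 2 · K + 2 √K (2 log √K)`
    have hA : s * Real.log s ≤ s * (7 * Real.log 2 - 1 + s / 128) :=
      mul_le_mul_of_nonneg_left hlogs hs0
    have hB : Real.log 2 * s ≤ 0.6931471808 * s := mul_le_mul_of_nonneg_right hl2.le hs0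
    have hC : Real.log 2 * K ≤ 0.6931471808 * K :=
      mul_le_mul_of_nonneg_right hl2.le (by positivity)
    have hKs : 100 * s ≤ K := by nlinarith
    nlinarith

/-- **`Σ_{n ≤ K} Λ(n)/n ≤ log K + 39/50` for every natural `K ≥ 1`**, by explicit sums:
`(K+1) Σ_{n≤K} Λ(n)/n − ψ(K) ≤ Σ_{n ≤ K} Λ(n)⌊K/n⌋ = log K! ≤ K log K − K + 1 + log K` and
`ψ(K) ≤ (89/50)K − 11/50`. [folklore] -/
theorem sum_vonMangoldt_div_le_log_add (K : ℕ) (hK : 1 ≤ K) :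
    ∑ n ∈ Finset.Icc 1 K, (vonMangoldt n : ℝ) / n ≤ Real.log K + 39 / 50 := by
  have hIcc : Finset.Icc 1 K = Finset.Ioc 0 K := by
    ext n
    simp only [Finset.mem_Icc, Finset.mem_Ioc]
    omega
  rw [hIcc]
  have hpsi : ψ (K : ℝ) = ∑ n ∈ Finset.Ioc 0 K, (vonMangoldt n : ℝ) := by
    rw [Chebyshev.psi, Nat.floor_natCast]
  -- `(K+1) ψ₁(K) − ψ(K) ≤ Σ Λ(n) ⌊K/n⌋`
  have hfloor : ((K : ℝ) + 1) * (∑ n ∈ Finset.Ioc 0 K, (vonMangoldt n : ℝ) / n) - ψ (K : ℝ) ≤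
      ∑ n ∈ Finset.Ioc 0 K, (vonMangoldt n : ℝ) * ((K / n : ℕ) : ℝ) := by
    rw [hpsi, Finset.mul_sum, ← Finset.sum_sub_distrib]
    refine Finset.sum_le_sum fun n hn ↦ ?_
    have hn0 : 0 < n := (Finset.mem_Ioc.1 hn).1
    have hn0' : (0 : ℝ) < n := by exact_mod_cast hn0
    have hdiv : K + 1 ≤ K / n * n + n := Nat.lt_div_mul_add hn0
    have hdiv' : (K : ℝ) + 1 ≤ ((K / n : ℕ) : ℝ) * n + n := by exact_mod_cast hdiv
    have hΛ : 0 ≤ (vonMangoldt n : ℝ) := ArithmeticFunction.vonMangoldt_nonneg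
    have hq : ((K : ℝ) + 1) / n - 1 ≤ ((K / n : ℕ) : ℝ) := by
      rw [div_sub_one hn0'.ne', div_le_iff₀ hn0']
      linarith
    calc ((K : ℝ) + 1) * ((vonMangoldt n : ℝ) / n) - vonMangoldt n
        = (vonMangoldt n : ℝ) * (((K : ℝ) + 1) / n - 1) := by ring
      _ ≤ (vonMangoldt n : ℝ) * ((K / n : ℕ) : ℝ) := mul_le_mul_of_nonneg_left hq hΛ
  rw [sum_vonMangoldt_mul_div_eq_sum_log] at hfloor
  have hT := sum_log_le hK
  have hψ := psi_le_of_one_le hK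
  have hK' : (1 : ℝ) ≤ K := by exact_mod_cast hK
  have h1 : ((K : ℝ) + 1) * (∑ n ∈ Finset.Ioc 0 K, (vonMangoldt n : ℝ) / n) ≤
      ((K : ℝ) + 1) * (Real.log K + 39 / 50) := by
    linarith
  exact le_of_mul_le_mul_left h1 (by linarith)

/-- The row sums of the Helson potential: for `1 ≤ m ≤ M`,
`log m + Σ_{n ≤ M/m} Λ(n)/n ≤ log M + 39/50` (`log m + log ⌊M/m⌋ ≤ log M`). [folklore] -/
theorem log_add_sum_vonMangoldt_div_le {M m : ℕ} (hm : m ∈ Finset.Icc 1 M) :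
    Real.log m + ∑ n ∈ Finset.Icc 1 (M / m), (vonMangoldt n : ℝ) / n ≤ Real.log M + 39 / 50 := by
  obtain ⟨hm1, hmM⟩ := Finset.mem_Icc.1 hm
  have hK : 1 ≤ M / m := (Nat.le_div_iff_mul_le hm1).2 (by simpa using hmM)
  have h := sum_vonMangoldt_div_le_log_add (M / m) hK
  have hm0 : (0 : ℝ) < m := by exact_mod_cast hm1
  have hK0 : (0 : ℝ) < ((M / m : ℕ) : ℝ) := by exact_mod_cast hK
  have hprod : (m : ℝ) * ((M / m : ℕ) : ℝ) ≤ M := by exact_mod_cast Nat.mul_div_le M m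
  have hlog : Real.log m + Real.log ((M / m : ℕ) : ℝ) ≤ Real.log M := by
    rw [← Real.log_mul hm0.ne' hK0.ne']
    exact Real.log_le_log (by positivity) hprod
  linarith

/-- **Stub S4 (`stub_helsonG`) — the Helson potential with the sharpened prime-power constant**,
explicit-sums proof: for every `M`, `a`,
`Σ_m ‖a_m‖² (log m + ψ₁(M/m)) ≤ (log M + 39/50) Σ ‖a_m‖²`, `ψ₁(y) = Σ_{n ≤ y} Λ(n)/n`
(termwise, from `ψ₁(K) ≤ log K + 39/50`, Chebyshev's identity `Σ Λ(n)⌊K/n⌋ = log K!` and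
`ψ(K) ≤ (89/50)K − 11/50`). [folklore] -/
theorem stub_helsonG : ∀ (M : ℕ) (a : ℕ → ℂ),
    ∑ m ∈ Finset.Icc 1 M, ‖a m‖ ^ 2 *
        (Real.log m + ∑ n ∈ Finset.Icc 1 (M / m), (ArithmeticFunction.vonMangoldt n : ℝ) / n) ≤
      (Real.log M + 39 / 50) * ∑ m ∈ Finset.Icc 1 M, ‖a m‖ ^ 2 := by
  intro M a
  rw [Finset.mul_sum]
  refine Finset.sum_le_sum fun m hm ↦ ?_
  rw [mul_comm (Real.log M + 39 / 50)]
  exact mul_le_mul_of_nonneg_left (log_add_sum_vonMangoldt_div_le hm) (by positivity)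

end Summit.RiemannHypothesis.RiemannHypothesis.Theorems.WeilCombBohrFejer.HelsonGK6

end
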